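import Literature.ModelTheory.FiniteModelTheory.CFIUncolouredProofs
import HarnessLib

/-!
# The uncoloured even and odd CFI graphs are not isomorphic (Chen–Flum–Liu 2025, Cor. 7.11) — proof

This file DISCHARGES the named fact
`Literature.ModelTheory.FiniteModelTheory.ChenFlumLiu2025_cfiEven_not_iso_cfiOdd` of
`CFIUncoloured.lean`:

* `ChenFlumLiu2025_cfiEven_not_iso_cfiOdd_holds` — for every base graph `G` on `Fin v` and every
  edge `e` of `G`, the untwisted uncoloured CFI graph `cfiEven G` (`Y(G)`) and the one-twist graph
  `cfiGraph G {e}` (`Ỹ(G) = Y^e(G)`, Def. 6.6) are NOT isomorphic.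

Source: Y. Chen, J. Flum, M. Liu, *Some remarks on the uncolored versions of the original
CFI-graphs*, arXiv:2507.01459 (2025). Cor. 7.11 (p. 37 of the PDF): "For all graphs `G`,
`Y(G) ≇ Ỹ(G)`." The paper offers two roads to it:

1. §6–§7 (the printed proof of Cor. 7.11): Lemma 6.8 settles `deg(G) ≤ 2` by hand (paths and
   cycles), and for `deg(G) ≥ 3` Prop. 7.10 shows that every isomorphism `Y(G) ≅ Y^T(G)` maps
   gadgets to gadgets (Lemmas 7.12–7.17, short cycles stay inside a gadget), after which the
   colour-blind parity argument of Thm. 6.7 / Cor. 7.9 applies.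
2. §12, Thm. 12.2 (p. 55, proof pp. 57–59): for the 2-subdivision `G₂` of `G`,
   `hom(G₂, Y(G)) > hom(G₂, Ỹ(G))` — uniformly in `G`, with no case distinction on degrees.
   Since the number of homomorphisms from a fixed graph is an isomorphism invariant of the
   target, this count separates `Y(G)` from `Ỹ(G)` outright.

We take road 2, which the tree already holds: `ChenFlumLiu2025.card_hom_subdiv_lt`
(`CFIUncolouredProofs.lean`, proved there for the discharge of Cor. 12.3) is exactly Thm. 12.2
in the form `Nat.card (G₂ →g Ỹ(G)) < Nat.card (G₂ →g Y(G))`. An isomorphism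
`φ : Y(G) ≃g Ỹ(G)` would give the bijection `f ↦ φ ∘ f` between the two homomorphism sets
(`card_hom_eq_of_iso`), contradicting the strict inequality. The standing hypotheses of the fact
("`G` connected", "`|G| ≥ 2`", pp. 16, 26 of the source) are not needed and not used.

## References

* [ChenFlumLiu2025] Y. Chen, J. Flum, M. Liu, *Some remarks on the uncolored versions of the
  original CFI-graphs*, arXiv:2507.01459 (2025): Cor. 7.11 (p. 37); Def. 6.6; §12, Thm. 12.2
  (p. 55), Example 12.4, Lemma 12.5, proof of Thm. 12.2 (pp. 57–59). Read via
  `lit read arxiv:2507.01459`.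
* [CaiFurerImmerman1992] J.-Y. Cai, M. Fürer, N. Immerman, *An optimal lower bound on the number
  of variables for graph identification*, Combinatorica 12 (1992), §6 (the coloured originals,
  whose non-isomorphism is proved with colours).
-/

namespace Literature.ModelTheory.FiniteModelTheory

/-! ### Homomorphism counts are an isomorphism invariant of the target -/

section HomTransport

variable {α β γ : Type*} {F : SimpleGraph α} {H₁ : SimpleGraph β} {H₂ : SimpleGraph γ}

/-- `hom(F, ·)` is invariant under isomorphism of the target: composition with an isomorphism
`φ : H₁ ≃g H₂` is a bijection `Hom(F, H₁) ≃ Hom(F, H₂)` (inverse: composition with `φ.symm`).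
[folklore] -/
theorem card_hom_eq_of_iso (φ : H₁ ≃g H₂) : Nat.card (F →g H₁) = Nat.card (F →g H₂) :=
  Nat.card_congr
    { toFun := fun f => φ.toHom.comp f
      invFun := fun g => φ.symm.toHom.comp g
      left_inv := fun f => RelHom.ext fun x => RelIso.symm_apply_apply φ (f x)
      right_inv := fun g => RelHom.ext fun x => RelIso.apply_symm_apply φ (g x) }

end HomTransport

/-! ### Cor. 7.11 -/

/-- **Chen–Flum–Liu 2025, Cor. 7.11, proved**: "For all graphs `G`, `Y(G) ≇ Ỹ(G)`" — the
uncoloured CFI graph `cfiEven G` with no twisted edge and the one `cfiGraph G {e}` with the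
single twisted edge `e ∈ E(G)` are not isomorphic. Proof via Thm. 12.2 of the source
(`ChenFlumLiu2025.card_hom_subdiv_lt`: the 2-subdivision `G₂` has strictly fewer homomorphisms
into `Ỹ(G)` than into `Y(G)`) and the isomorphism invariance of homomorphism counts
(`card_hom_eq_of_iso`). The hypotheses "`G` connected" and "`2 ≤ v`" of the fact are not used.
[cite: ChenFlumLiu2025, Cor. 7.11 (via Thm. 12.2, pp. 55–59)] -/
theorem ChenFlumLiu2025_cfiEven_not_iso_cfiOdd_holds : ChenFlumLiu2025_cfiEven_not_iso_cfiOdd := by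
  intro v G _ _ _ e he _
  refine ⟨fun φ => ?_⟩
  have hlt := ChenFlumLiu2025.card_hom_subdiv_lt (G := G) he
  have heq := card_hom_eq_of_iso (F := ChenFlumLiu2025.subdiv G) φ
  omega

end Literature.ModelTheory.FiniteModelTheory
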